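import Literature.RepresentationTheory.CharacterExtensionCocycle
import Mathlib.GroupTheory.OrderOfElement

/-!
# Self-extensions of a character: the additive character and the unipotent model `χ ⊗ [[1, λ],[0, 1]]` («CHAR-EXT COCYCLE» II)

Companion of `CharacterExtensionCocycle.lean` (same letters: `ρ : Representation k G V`, a character `χ : G →* k`, a functional
`p : V →ₗ[k] k` with `hquot : p (ρ g v) = χ g * p v` and `hker : p v = 0 → ρ g v = χ g • v`, a base vector `u` with `p u = 1`;
«SPLIT» = `∃ v₀, p v₀ = 1 ∧ ∀ g, ρ g v₀ = χ g • v₀`).  THEOREMS ONLY (no `def`, no `instance`, no named fact), Mathlib-only.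

* §0 THE FINITE-INDEX TEST: if a normal subgroup `N` of finite index `[G : N]` invertible in `k` acts trivially on a
  self-extension of `χ`, every `g` acts by the scalar `χ g` (`g ^ [G:N] ∈ N` + the companion's finite-order test) — «a
  compact group acting smoothly on a finite-dimensional self-extension of `χ` acts by `χ`», in finite-index currency.
* §1 THE ADDITIVE CHARACTER («`Ext¹(χ, χ) = Hom(G, k)`»): for unit-valued `χ` (automatic on groups) a self-extension with base
  vector `u` determines `Λ : G → ker p` with `Λ 1 = 0`, `Λ (g h) = Λ g + Λ h` and `ρ g u = χ g • (u + Λ g)` (namely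
  `Λ = χ⁻¹ • D_u`); `Λ` is determined by these equations, and SPLIT ⟺ `Λ = 0`.
* §2 THE UNIPOTENT MODEL on `k × k`: for every additive `lam : G → k` there is a representation
  `g ↦ ((x, y) ↦ (χ g x + χ g (lam g) y, χ g y))`, i.e. `χ g • [[1, lam g],[0, 1]]` in the basis `e = (1,0)`, `u = (0,1)`; it is a
  self-extension of `χ` for `p = snd`, its additive character is `lam • e`, it SPLITS IFF `lam = 0` (the non-split
  self-extension attached to a non-zero additive `lam`), and every self-extension of `χ` whose `ker p` is a free line `k e` is
  isomorphic over `p` to the model of its own `lam` (UNIVERSALITY).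
* §3 FUNCTORIALITY: for a `k`-linear `f : V → V'` equivariant on `u` between two self-extensions of `χ`,
  `f ∘ Λ = p' (f u) • Λ'` (pull-back ∕ push-out ∕ rescaling multiply `Λ` by a scalar; sub- and isomorphic extensions have
  proportional characters); and the ONE-PARAMETER DETERMINATION `Λ g = ord g • Λ t₀` for an additive `Λ` killed by a set `S`
  with `G = ⟨S, t₀⟩`, `ord` additive, `ord|_S = 0`, `ord t₀ = 1` (the smooth additive characters of a torus `T_c · t₀^ℤ` form
  one line).

SOURCES (what is formalised, read at our letters).  K. S. Brown, *Cohomology of Groups* (GTM 87), Ch. III §1 Exercise 2, p. 60: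
`H¹(G, M)` is derivations modulo principal derivations, and «if `G` acts trivially on `M` then `H¹(G, M) ≈ Hom(G, M)`» — read at
the self-extension `0 → ker p → V → k_χ → 0`: after untwisting by `χ` the coefficient bimodule `ker p` is TRIVIAL, so the
derivation `D_u` of the companion file is `χ • Λ` for an additive HOMOMORPHISM `Λ : G → ker p`, independent of `u`, and the
extension splits iff `Λ = 0` (§1); and Ch. IV §2, pp. 88–89 with Prop. 2.1: the section `s(g) = (dg, g)` of the semi-direct
product realises a given derivation — read for modules as the unipotent matrices `χ g • [[1, lam g],[0, 1]]` realising a given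
additive `lam`, with the split case `lam = 0` = the direct sum (§2).  The abstract isomorphism `H¹ ≃ Hom` for a trivial module is
Mathlib's `groupCohomology.H1LequivOfIsTrivial` (not restated; consumers hold explicit `p`, `u`, `Λ`).  Deliberately NOT here:
`Ext` as an object, Baer sum ∕ linearity of `V ↦ Λ`, continuity of `Λ`.
-/

set_option autoImplicit false

namespace Literature.RepresentationTheory

variable {k : Type*} [CommRing k] {G : Type*} {V : Type*} [AddCommGroup V] [Module k V]

/-! ## §0 The finite-index test -/

section FiniteIndex

variable [Group G]

/-- **FINITE-INDEX TEST.**  If a NORMAL subgroup `N` of finite index acts trivially on a self-extension of `χ` and the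
index `[G : N]` is a unit of `k`, then EVERY `g` acts by the scalar `χ g` (`g ^ [G:N] ∈ N`, Mathlib
`Subgroup.pow_index_mem`, then `eq_smul_one_of_pow_eq_one`).  With the tree's finite-index fixed-vector lemmas
(`FixedPointsTraceAverage`, `TwistedCoinvariantsCompactFixedLift`) this reads «a compact group acting smoothly on a
finite-dimensional self-extension of `χ` acts by `χ`». [cite: Brown1982, Ch. III §1 Exercise 2 p. 60] -/
theorem forall_eq_smul_one_of_forall_mem_eq_one (ρ : Representation k G V) (χ : G →* k) (p : V →ₗ[k] k)
    (hquot : ∀ g v, p (ρ g v) = χ g * p v) (hker : ∀ g v, p v = 0 → ρ g v = χ g • v) {u : V} (hu : p u = 1)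
    (N : Subgroup G) [N.Normal] [N.FiniteIndex] (hN : ∀ n ∈ N, ρ n = 1) (hidx : IsUnit ((N.index : ℕ) : k))
    (g : G) : ρ g = χ g • (1 : Module.End k V) :=
  eq_smul_one_of_pow_eq_one ρ χ p hquot hker hu
    (by rw [← map_pow]; exact hN _ (Subgroup.pow_index_mem N g)) hidx

end FiniteIndex

/-! ## §1 The additive character of a self-extension -/

section AdditiveCharacter

variable [Monoid G]

/-- **THE ADDITIVE CHARACTER OF A SELF-EXTENSION** («`Ext¹(χ, χ) = Hom(G, k)`»).  If `χ` is unit-valued (automatic for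
groups), a self-extension of `χ` with base vector `u` determines a function `Λ : G → ker p` with `Λ 1 = 0`,
`Λ (g h) = Λ g + Λ h` (an additive homomorphism) and `ρ g u = χ g • (u + Λ g)`; namely `Λ g = (χ g)⁻¹ • D_u g`.
[cite: Brown1982, Ch. III §1 Exercise 2 p. 60 («if `G` acts trivially, `H¹(G, M) ≈ Hom(G, M)`»)] -/
theorem exists_additive_apply_base_eq (ρ : Representation k G V) (χ : G →* k) (p : V →ₗ[k] k)
    (hquot : ∀ g v, p (ρ g v) = χ g * p v) (hker : ∀ g v, p v = 0 → ρ g v = χ g • v) (hχ : ∀ g, IsUnit (χ g))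
    (u : V) :
    ∃ Λ : G → V, Λ 1 = 0 ∧ (∀ g h, Λ (g * h) = Λ g + Λ h) ∧ (∀ g, p (Λ g) = 0) ∧
      ∀ g, ρ g u = χ g • (u + Λ g) := by
  refine ⟨fun g => (((hχ g).unit⁻¹ : kˣ) : k) • (ρ g u - χ g • u), ?_, fun g h => ?_, fun g => ?_, fun g => ?_⟩
  · simp only [derivation_one, smul_zero]
  · -- divide the twisted Leibniz rule by `χ g χ h`
    dsimp only
    have hL := derivation_mul ρ χ χ p hquot hker u g h
    have hgh : (((hχ (g * h)).unit⁻¹ : kˣ) : k) = (((hχ h).unit⁻¹ : kˣ) : k) * (((hχ g).unit⁻¹ : kˣ) : k) := by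
      have e1 : (((hχ (g * h)).unit⁻¹ : kˣ) : k) * (χ g * χ h) = 1 := by
        rw [← map_mul, IsUnit.val_inv_mul]
      have e2 : (((hχ h).unit⁻¹ : kˣ) : k) * (((hχ g).unit⁻¹ : kˣ) : k) * (χ g * χ h) = 1 := by
        calc _ = ((((hχ g).unit⁻¹ : kˣ) : k) * χ g) * ((((hχ h).unit⁻¹ : kˣ) : k) * χ h) := by ring
          _ = 1 := by rw [IsUnit.val_inv_mul, IsUnit.val_inv_mul, one_mul]
      have hu' : IsUnit (χ g * χ h) := (hχ g).mul (hχ h)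
      exact hu'.mul_right_cancel (e1.trans e2.symm)
    rw [hL, hgh, smul_add, smul_smul, smul_smul]
    have c1 : (((hχ h).unit⁻¹ : kˣ) : k) * (((hχ g).unit⁻¹ : kˣ) : k) * χ g = (((hχ h).unit⁻¹ : kˣ) : k) := by
      rw [mul_assoc, IsUnit.val_inv_mul, mul_one]
    have c2 : (((hχ h).unit⁻¹ : kˣ) : k) * (((hχ g).unit⁻¹ : kˣ) : k) * χ h = (((hχ g).unit⁻¹ : kˣ) : k) := by
      rw [mul_comm (((hχ h).unit⁻¹ : kˣ) : k), mul_assoc, IsUnit.val_inv_mul, mul_one]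
    rw [c1, c2, add_comm]
  · dsimp only
    rw [map_smul, apply_sub_smul_mem_ker ρ χ p hquot, smul_zero]
  · dsimp only
    rw [smul_add, smul_smul, IsUnit.mul_val_inv, one_smul, add_sub_cancel]

/-- Uniqueness of the additive character: if `ρ g u = χ g • (u + Λ g)` with `χ g` a unit then `χ g • Λ g = D_u g`, so `Λ`
is determined by the extension and the class `p u` of `u` (rigidity). [cite: Brown1982, Ch. III §1 Exercise 2 p. 60] -/
theorem smul_additive_eq_derivation (ρ : Representation k G V) (χ : G →* k) {u : V} {Λ : G → V} {g : G}
    (hΛ : ρ g u = χ g • (u + Λ g)) : χ g • Λ g = ρ g u - χ g • u := by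
  rw [hΛ, smul_add, add_sub_cancel_left]

/-- **SPLIT ⟺ THE ADDITIVE CHARACTER VANISHES.**  With `ρ g u = χ g • (u + Λ g)` for all `g` (`χ` unit-valued, `p u = 1`):
an equivariant section exists iff `Λ = 0`. [cite: Brown1982, Ch. III §1 Exercise 2 p. 60; Ch. IV §2 Prop. 2.3 p. 89] -/
theorem exists_fixedVector_iff_additive_eq_zero (ρ : Representation k G V) (χ : G →* k) (p : V →ₗ[k] k)
    (hker : ∀ g v, p v = 0 → ρ g v = χ g • v) (hχ : ∀ g, IsUnit (χ g)) {u : V} (hu : p u = 1) {Λ : G → V}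
    (hΛ : ∀ g, ρ g u = χ g • (u + Λ g)) :
    (∃ v₀ : V, p v₀ = 1 ∧ ∀ g, ρ g v₀ = χ g • v₀) ↔ ∀ g, Λ g = 0 := by
  rw [exists_fixedVector_iff_forall_eq_smul_one ρ χ p hker hu,
    forall_eq_smul_one_iff_forall_apply_base ρ χ p hker hu]
  refine forall_congr' fun g => ?_
  rw [hΛ g, smul_add, add_eq_left]
  refine ⟨fun h => ?_, fun h => by rw [h, smul_zero]⟩
  have := congrArg (fun x => (((hχ g).unit⁻¹ : kˣ) : k) • x) h
  simpa only [smul_smul, IsUnit.val_inv_mul, one_smul, smul_zero] using this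

end AdditiveCharacter

/-! ## §2 The unipotent model `χ ⊗ [[1, lam],[0, 1]]` on `k × k` -/

section Model

variable [Monoid G]

/-- **EXISTENCE OF THE UNIPOTENT MODEL.**  For a character `χ` and an additive function `lam : G → k` (`lam 1 = 0`,
`lam (g h) = lam g + lam h`) there is a representation of `G` on `k × k` acting by `(x, y) ↦ (χ g x + χ g lam g y, χ g y)`, i.e. by
the matrices `χ g • [[1, lam g],[0, 1]]` in the basis `e = (1,0)`, `u = (0,1)`.
[cite: Brown1982, Ch. IV §2 pp. 88–89 (the splitting `s(g) = (dg, g)` of `A ⋊ G`), read for modules] -/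
theorem exists_representation_unipotent_model (χ : G →* k) (lam : G → k) (hlam1 : lam 1 = 0)
    (hlam : ∀ g h, lam (g * h) = lam g + lam h) :
    ∃ ρ : Representation k G (k × k), ∀ g x y, ρ g (x, y) = (χ g * x + χ g * lam g * y, χ g * y) := by
  let M : G → (k × k) →ₗ[k] (k × k) := fun g =>
    { toFun := fun v => (χ g * v.1 + χ g * lam g * v.2, χ g * v.2)
      map_add' := fun v w => by
        simp only [Prod.fst_add, Prod.snd_add, Prod.mk_add_mk]
        ext <;> ring
      map_smul' := fun c v => by
        simp only [Prod.smul_fst, Prod.smul_snd, smul_eq_mul, RingHom.id_apply, Prod.smul_mk]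
        ext <;> ring }
  have hM : ∀ g x y, M g (x, y) = (χ g * x + χ g * lam g * y, χ g * y) := fun g x y => rfl
  refine ⟨{ toFun := M, map_one' := ?_, map_mul' := fun g h => ?_ }, fun g x y => rfl⟩
  · apply LinearMap.ext
    rintro ⟨x, y⟩
    rw [hM, map_one, hlam1, Module.End.one_apply]
    ext <;> simp
  · apply LinearMap.ext
    rintro ⟨x, y⟩
    rw [Module.End.mul_apply, hM, hM, hM, map_mul, hlam]
    ext <;> simp only <;> ring

/-- The model IS a self-extension of `χ`: with `p = snd`, `p ∘ ρ g = χ g • p` (quotient character `χ`) and `G` acts by `χ` on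
`ker p = k × 0`. [cite: Brown1982, Ch. IV §2 pp. 88–89] -/
theorem unipotent_model_quot_ker (χ : G →* k) (lam : G → k) (ρ : Representation k G (k × k))
    (hρ : ∀ g x y, ρ g (x, y) = (χ g * x + χ g * lam g * y, χ g * y)) :
    (∀ g (v : k × k), LinearMap.snd k k k (ρ g v) = χ g * LinearMap.snd k k k v) ∧
      ∀ g (v : k × k), LinearMap.snd k k k v = 0 → ρ g v = χ g • v := by
  refine ⟨fun g v => ?_, fun g v hv => ?_⟩
  · obtain ⟨x, y⟩ := v
    rw [hρ, LinearMap.snd_apply, LinearMap.snd_apply]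
  · obtain ⟨x, y⟩ := v
    rw [LinearMap.snd_apply] at hv
    subst hv
    rw [hρ, Prod.smul_mk, smul_eq_mul, smul_eq_mul, mul_zero, mul_zero, add_zero]

/-- The base vector `u = (0, 1)` of the model and its derivation: `ρ g u - χ g • u = (χ g lam g) • (1, 0)`, i.e. the additive
character of the model (§1) is `g ↦ lam g • e`. [cite: Brown1982, Ch. IV §2 pp. 88–89] -/
theorem unipotent_model_derivation (χ : G →* k) (lam : G → k) (ρ : Representation k G (k × k))
    (hρ : ∀ g x y, ρ g (x, y) = (χ g * x + χ g * lam g * y, χ g * y)) (g : G) :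
    ρ g ((0 : k), (1 : k)) - χ g • ((0 : k), (1 : k)) = (χ g * lam g) • ((1 : k), (0 : k)) ∧
      ρ g ((0 : k), (1 : k)) = χ g • (((0 : k), (1 : k)) + lam g • ((1 : k), (0 : k))) := by
  refine ⟨?_, ?_⟩
  · rw [hρ, Prod.smul_mk, Prod.smul_mk, Prod.mk_sub_mk, smul_eq_mul, smul_eq_mul, smul_eq_mul, smul_eq_mul]
    ext <;> simp
  · rw [hρ, Prod.smul_mk, Prod.mk_add_mk, Prod.smul_mk, smul_eq_mul, smul_eq_mul, smul_eq_mul, smul_eq_mul]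
    ext <;> simp

/-- **THE MODEL SPLITS IFF `lam = 0`** (for unit-valued `χ`): `χ ⊗ [[1, lam],[0, 1]]` has an equivariant complement to the line
`k × 0` iff the additive character `lam` vanishes identically — the non-split self-extension of `χ` attached to a non-zero
additive `lam : G → k`. [cite: Brown1982, Ch. III §1 Exercise 2 p. 60; Ch. IV §2 Prop. 2.3 p. 89] -/
theorem unipotent_model_split_iff (χ : G →* k) (hχ : ∀ g, IsUnit (χ g)) (lam : G → k)
    (ρ : Representation k G (k × k)) (hρ : ∀ g x y, ρ g (x, y) = (χ g * x + χ g * lam g * y, χ g * y)) :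
    (∃ v₀ : k × k, LinearMap.snd k k k v₀ = 1 ∧ ∀ g, ρ g v₀ = χ g • v₀) ↔ ∀ g, lam g = 0 := by
  obtain ⟨hquot, hker⟩ := unipotent_model_quot_ker χ lam ρ hρ
  have hu : LinearMap.snd k k k ((0 : k), (1 : k)) = 1 := rfl
  rw [exists_fixedVector_iff_additive_eq_zero ρ χ (LinearMap.snd k k k) hker hχ hu
    (Λ := fun g => lam g • ((1 : k), (0 : k))) (fun g => (unipotent_model_derivation χ lam ρ hρ g).2)]
  refine forall_congr' fun g => ?_
  rw [Prod.smul_mk, smul_eq_mul, smul_eq_mul, mul_one, mul_zero, Prod.mk_eq_zero]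
  exact ⟨fun h => h.1, fun h => ⟨h, rfl⟩⟩

/-- **UNIVERSALITY OF THE MODEL.**  Let `V` be a self-extension of `χ` (data `ρ, p, hker`) with base vector `u` (`p u = 1`) whose
kernel is the free line on a vector `e` (`p e = 0`, every `w ∈ ker p` is a multiple of `e`, and `c • e = 0 ⇒ c = 0`), and let
`Λ : G → k` record the derivation, `ρ g u - χ g • u = (χ g * Λ g) • e`.  Then `(x, y) ↦ x • e + y • u` is a `k`-linear
ISOMORPHISM `k × k ≃ V` over `p` (second coordinate) intertwining the model `χ ⊗ [[1, Λ],[0, 1]]` with `ρ`.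
[cite: Brown1982, Ch. IV §2 Prop. 2.1 p. 87 and pp. 88–89] -/
theorem exists_linearEquiv_unipotent_model (ρ : Representation k G V) (χ : G →* k) (p : V →ₗ[k] k)
    (hker : ∀ g v, p v = 0 → ρ g v = χ g • v) {u e : V} (hu : p u = 1) (he : p e = 0)
    (hline : ∀ w, p w = 0 → ∃ c : k, w = c • e) (hfree : ∀ c : k, c • e = 0 → c = 0) (Λ : G → k)
    (hΛ : ∀ g, ρ g u - χ g • u = (χ g * Λ g) • e) :
    ∃ Φ : (k × k) ≃ₗ[k] V, (∀ x y, Φ (x, y) = x • e + y • u) ∧ (∀ v, p (Φ v) = LinearMap.snd k k k v) ∧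
      ∀ g x y, ρ g (Φ (x, y)) = Φ (χ g * x + χ g * Λ g * y, χ g * y) := by
  let φ : (k × k) →ₗ[k] V := (LinearMap.lsmul k V).flip e ∘ₗ LinearMap.fst k k k +
    (LinearMap.lsmul k V).flip u ∘ₗ LinearMap.snd k k k
  have hφ : ∀ x y, φ (x, y) = x • e + y • u := fun x y => rfl
  have hpφ : ∀ v, p (φ v) = LinearMap.snd k k k v := by
    rintro ⟨x, y⟩
    rw [hφ, map_add, map_smul, map_smul, he, hu, smul_zero, zero_add, smul_eq_mul, mul_one, LinearMap.snd_apply]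
  have hinj : Function.Injective φ := by
    rw [← LinearMap.ker_eq_bot, Submodule.eq_bot_iff]
    rintro ⟨x, y⟩ hxy
    rw [LinearMap.mem_ker] at hxy
    have hy : y = 0 := by
      have h := hpφ (x, y)
      rw [hxy, map_zero, LinearMap.snd_apply] at h
      exact h.symm
    subst hy
    rw [hφ, zero_smul, add_zero] at hxy
    rw [hfree x hxy, Prod.mk_zero_zero]
  have hsurj : Function.Surjective φ := by
    intro v
    obtain ⟨c, hc⟩ := hline (v - p v • u) (by rw [map_sub, map_smul, hu, smul_eq_mul, mul_one, sub_self])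
    refine ⟨(c, p v), ?_⟩
    rw [hφ, ← hc, sub_add_cancel]
  refine ⟨LinearEquiv.ofBijective φ ⟨hinj, hsurj⟩, fun x y => rfl, hpφ, fun g x y => ?_⟩
  rw [LinearEquiv.ofBijective_apply, LinearEquiv.ofBijective_apply, hφ, hφ, map_add, map_smul, map_smul,
    hker g e he]
  have hgu : ρ g u = χ g • u + (χ g * Λ g) • e := by rw [← hΛ g, add_sub_cancel]
  rw [hgu]
  module

end Model

/-! ## §3 Functoriality of the additive character and the one-parameter case -/

section Functorial

variable [Monoid G] {V' : Type*} [AddCommGroup V'] [Module k V']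

/-- **TRANSPORT LAW.**  Let `(V, ρ, p, u, Λ)` and `(V', ρ', p', u', Λ')` be self-extensions of the same unit-valued character
`χ` with their additive characters (`ρ g u = χ g • (u + Λ g)`, `ρ' g u' = χ g • (u' + Λ' g)`, `p' u' = 1`), and let
`f : V → V'` be `k`-linear and equivariant on `u` (`f (ρ g u) = ρ' g (f u)`).  Then `f ∘ Λ = p' (f u) • Λ'`: the additive
character is FUNCTORIAL, scaled by the scalar that `f` induces on the quotient line.  (Pull-back along multiplication by
`c` on the quotient ⇒ `Λ ↦ c • Λ`; push-out along `b` on the kernel ⇒ `Λ ↦ b • Λ`; sub-∕quotient-∕isomorphic extensions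
have proportional characters; no unit hypothesis on `p' (f u)` — if `f` lands in `ker p'` then `f ∘ Λ = 0`.)
[cite: Brown1982, Ch. III §1 Exercise 2 p. 60; Ch. IV §2 Prop. 2.3 p. 89] -/
theorem apply_additive_eq_smul_additive (ρ : Representation k G V) (ρ' : Representation k G V') (χ : G →* k)
    (hχ : ∀ g, IsUnit (χ g)) (p' : V' →ₗ[k] k) (hker' : ∀ g v, p' v = 0 → ρ' g v = χ g • v)
    {u : V} {u' : V'} (hu' : p' u' = 1) {Λ : G → V} (hΛ : ∀ g, ρ g u = χ g • (u + Λ g))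
    {Λ' : G → V'} (hΛ' : ∀ g, ρ' g u' = χ g • (u' + Λ' g)) (f : V →ₗ[k] V')
    (hfu : ∀ g, f (ρ g u) = ρ' g (f u)) (g : G) :
    f (Λ g) = p' (f u) • Λ' g := by
  -- decompose `f u = p'(f u) • u' + w` with `w ∈ ker p'`
  have hw : p' (f u - p' (f u) • u') = 0 := by rw [map_sub, map_smul, hu', smul_eq_mul, mul_one, sub_self]
  have h1 : f (ρ g u) = χ g • f u + χ g • f (Λ g) := by rw [hΛ g, map_smul, map_add, smul_add]
  have h2 : ρ' g (f u) = χ g • f u + (p' (f u) * χ g) • Λ' g := by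
    have hsplit : f u = p' (f u) • u' + (f u - p' (f u) • u') := by abel
    conv_lhs => rw [hsplit]
    rw [map_add, map_smul, hΛ' g, hker' g _ hw]
    module
  have h3 : χ g • f (Λ g) = (p' (f u) * χ g) • Λ' g := by
    have := hfu g
    rw [h1, h2] at this
    exact add_left_cancel this
  have := congrArg (fun x => (((hχ g).unit⁻¹ : kˣ) : k) • x) h3
  simp only [smul_smul, IsUnit.val_inv_mul, one_smul] at this
  rw [this, mul_comm (p' (f u)), ← mul_assoc, IsUnit.val_inv_mul, one_mul]

/-- **RESCALING THE QUOTIENT** (pull-back along a scalar).  On ONE representation, two base data `(p, u, Λ)` and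
`(p', u', Λ')` for the same `χ` whose functionals have the same kernel behaviour (`hker'` for `p'`) have proportional
additive characters: `Λ g = p' u • Λ' g` — the identity map transports. [cite: Brown1982, Ch. III §1 Exercise 2 p. 60] -/
theorem additive_eq_smul_additive_of_rescale (ρ : Representation k G V) (χ : G →* k) (hχ : ∀ g, IsUnit (χ g))
    (p' : V →ₗ[k] k) (hker' : ∀ g v, p' v = 0 → ρ g v = χ g • v) {u u' : V} (hu' : p' u' = 1)
    {Λ : G → V} (hΛ : ∀ g, ρ g u = χ g • (u + Λ g)) {Λ' : G → V} (hΛ' : ∀ g, ρ g u' = χ g • (u' + Λ' g))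
    (g : G) : Λ g = p' u • Λ' g := by
  have h := apply_additive_eq_smul_additive ρ ρ χ hχ p' hker' hu' hΛ hΛ' LinearMap.id (fun _ => rfl) g
  simpa only [LinearMap.id_apply] using h

end Functorial

section OneParameter

variable [Group G]

/-- **ONE-PARAMETER DETERMINATION.**  An additive map `Λ : G → M` on a group that vanishes on a set `S` is determined by
its value at one further generator: if `G` is generated by `S` and `t₀` and `ord : G → ℤ` is additive with `ord = 0` on
`S` and `ord t₀ = 1`, then `Λ g = ord g • Λ t₀` for every `g`.  (For a `p`-adic torus `T = T_c · t₀^ℤ`: an additive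
character killed by the compact part — e.g. by the finite-index test — is `Λ(t₀)`-times the valuation, so the additive
characters of smooth self-extensions form ONE line.) [cite: Brown1982, Ch. III §1 Exercise 2 p. 60 («`Hom(G, M) = Hom(G_ab, M)`»)] -/
theorem additive_eq_zsmul_of_closure_insert {M : Type*} [AddCommGroup M] (Λ : G → M)
    (hΛ : ∀ g h, Λ (g * h) = Λ g + Λ h) (ord : G → ℤ) (hord : ∀ g h, ord (g * h) = ord g + ord h)
    {S : Set G} {t₀ : G} (hS : Subgroup.closure (insert t₀ S) = ⊤) (hΛS : ∀ s ∈ S, Λ s = 0)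
    (hordS : ∀ s ∈ S, ord s = 0) (hordt : ord t₀ = 1) (g : G) : Λ g = ord g • Λ t₀ := by
  have hΛ1 : Λ 1 = 0 := by
    have h := hΛ 1 1
    rw [mul_one] at h
    exact left_eq_add.mp h
  have hord1 : ord 1 = 0 := by
    have h := hord 1 1
    rw [mul_one] at h
    exact left_eq_add.mp h
  have hΛinv : ∀ x, Λ x⁻¹ = -Λ x := fun x => by
    have h := hΛ x⁻¹ x
    rw [inv_mul_cancel, hΛ1] at h
    exact (neg_eq_of_add_eq_zero_left h.symm).symm
  have hordinv : ∀ x, ord x⁻¹ = -ord x := fun x => by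
    have h := hord x⁻¹ x
    rw [inv_mul_cancel, hord1] at h
    omega
  have hg : g ∈ Subgroup.closure (insert t₀ S) := by rw [hS]; exact Subgroup.mem_top g
  induction hg using Subgroup.closure_induction with
  | mem x hx =>
    rcases Set.mem_insert_iff.mp hx with rfl | hx'
    · rw [hordt, one_zsmul]
    · rw [hΛS x hx', hordS x hx', zero_zsmul]
  | one => rw [hΛ1, hord1, zero_zsmul]
  | mul x y _ _ hx hy => rw [hΛ, hord, hx, hy, add_zsmul]
  | inv x _ hx => rw [hΛinv, hordinv, hx, neg_zsmul]

end OneParameter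

end Literature.RepresentationTheory
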